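import Literature.NumberTheory.Weil1964.AdelicSiegelParabolicLift
import Literature.NumberTheory.Weil1964.ArchMetaplecticExtension
import HarnessLib

/-!
# The Siegel decomposition `g = m(a, d) n(b)` in weil-1's `Sp(ℝ^σ × ℝ^σ)` (dot pairing)

Topic `NumberTheory/Weil1964`; namespace `Literature.NumberTheory.Weil1964`.  KERNEL MATHEMATICS ONLY: proved
theorems; no definition, no `def … : Prop` record, no axiom, no proof hole.

`AdelicSiegelParabolicLift` §2 proves, over any commutative ring `K` with `2` invertible and Gram matrix `T` with
`IsUnit T.det`, Weil's normal form [Weil1964, Chap. III n° 46 (42)]: an element of the Siegel parabolic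
`P_Y = {p ∈ Sp(K^ι × K^ι, polar β_T) | p(Y) = Y}` is `m(a_p, d_p) · n(c_p)` (`SiegelParabolicPi.eq_leviSp_mul_unipotentSp`).
This file reads it in weil-1's archimedean group `Sp(W) = symplecticGroup (polar (dotPairing σ))` (`K = ℝ`, `T = 1`;
`β_1 = dotPairing`, `toLinearMap₂'_one_eq_dotPairing` of `ArchMetaplecticExtension`), the group over which
`Mp^𝓢(W) = MpS σ` and Folland's implementers `levi`, `unip` live:

* `symplecticGroup_dotPairing_eq` — the two symplectic groups are the same subgroup of `GL(ℝ^σ × ℝ^σ)`;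
* **`exists_eq_leviSp_mul_unipotentSp_of_preserves`** — if `g ∈ Sp(W)` and `g⁻¹` map `0 × ℝ^σ` into `0 × ℝ^σ`, then
  `g = leviSp (dotPairing σ) a d had · unipotentSp (dotPairing σ) b hb` with `a x = (g(x, 0)).1` (`a` = the `X`-block);
  so `det a` is the determinant of `x ↦ (g(x,0)).1` (`det_levi_of_preserves`).

## References

* [Weil1964] A. Weil, Acta Math. 111 (1964), Chap. III n° 46, (42) p. 202.
* [Folland1989] G. B. Folland, *Harmonic Analysis in Phase Space*, Princeton UP 1989, §4.1 Prop. (4.10), §4.2 (4.24)–(4.25).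
-/

set_option autoImplicit false

noncomputable section

namespace Literature.NumberTheory.Weil1964

open Literature.RepresentationTheory.HeisenbergGroup Literature.RepresentationTheory.HeisenbergGroup.SymplecticMatrix
open Literature.Analysis.SegalBargmann

variable {σ : Type*} [Fintype σ] [DecidableEq σ]

/-- `Sp(ℝ^σ × ℝ^σ)` for the dot pairing IS `Sp` for `β_1 = toLinearMap₂' 1`. [cite: Weil1964, Chap. III n° 46 p. 201] -/
theorem symplecticGroup_dotPairing_eq :
    symplecticGroup (polar (dotPairing σ)) = symplecticGroup (polar (Matrix.toLinearMap₂' ℝ (1 : Matrix σ σ ℝ))) := by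
  rw [toLinearMap₂'_one_eq_dotPairing]

/-- an element of `Sp(ℝ^σ × ℝ^σ)` read in `Sp(β_1)`. [cite: Weil1964, Chap. III n° 46 p. 201] -/
theorem mem_symplecticGroup_toLinearMap₂'_one (g : symplecticGroup (polar (dotPairing σ))) :
    (g.1 : ((σ → ℝ) × (σ → ℝ)) ≃ₗ[ℝ] ((σ → ℝ) × (σ → ℝ))) ∈
      symplecticGroup (polar (Matrix.toLinearMap₂' ℝ (1 : Matrix σ σ ℝ))) := by
  rw [← symplecticGroup_dotPairing_eq]; exact g.2

/-- **WEIL'S NORMAL FORM IN `Sp(ℝ^σ × ℝ^σ)`**: a symplectic `g` with `g(0 × ℝ^σ) ⊆ 0 × ℝ^σ ⊇ g⁻¹(0 × ℝ^σ)` is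
`m(a, d) n(b)` with `a x = (g(x, 0)).1`. [cite: Weil1964, Chap. III n° 46, (42) p. 202; Folland1989, §4.2 (4.24)–(4.25)] -/
theorem exists_eq_leviSp_mul_unipotentSp_of_preserves (g : symplecticGroup (polar (dotPairing σ)))
    (h1 : ∀ y : σ → ℝ, ((g.1 : ((σ → ℝ) × (σ → ℝ)) ≃ₗ[ℝ] ((σ → ℝ) × (σ → ℝ))) (0, y)).1 = 0)
    (h2 : ∀ y : σ → ℝ, ((g.1 : ((σ → ℝ) × (σ → ℝ)) ≃ₗ[ℝ] ((σ → ℝ) × (σ → ℝ))).symm (0, y)).1 = 0) :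
    ∃ (a d : (σ → ℝ) ≃ₗ[ℝ] (σ → ℝ)) (had : ∀ x y, dotPairing σ (a x) (d y) = dotPairing σ x y)
      (b : (σ → ℝ) →ₗ[ℝ] (σ → ℝ)) (hb : ∀ x x', dotPairing σ x (b x') = dotPairing σ x' (b x)),
      g = leviSp (dotPairing σ) a d had * unipotentSp (dotPairing σ) b hb ∧
        ∀ x, a x = ((g.1 : ((σ → ℝ) × (σ → ℝ)) ≃ₗ[ℝ] ((σ → ℝ) × (σ → ℝ))) (x, 0)).1 := by
  set g' : symplecticGroup (polar (Matrix.toLinearMap₂' ℝ (1 : Matrix σ σ ℝ))) :=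
    ⟨g.1, mem_symplecticGroup_toLinearMap₂'_one g⟩ with hg'
  have hp : g' ∈ siegelParabolicPi (1 : Matrix σ σ ℝ) := ⟨h1, h2⟩
  have hT : IsUnit (1 : Matrix σ σ ℝ).det := by rw [Matrix.det_one]; exact isUnit_one
  have key := SiegelParabolicPi.eq_leviSp_mul_unipotentSp (T := (1 : Matrix σ σ ℝ)) hT hp
  refine ⟨glEquiv (SiegelParabolicPi.aGL hp), leviDual (1 : Matrix σ σ ℝ) hT (SiegelParabolicPi.aGL hp), fun x y => ?_,
    lowLin (1 : Matrix σ σ ℝ) (SiegelParabolicPi.cMat (T := (1 : Matrix σ σ ℝ)) g'), fun x x' => ?_, ?_, fun x => ?_⟩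
  · have h := leviDual_compat (1 : Matrix σ σ ℝ) hT (SiegelParabolicPi.aGL hp) x y
    rwa [toLinearMap₂'_one_eq_dotPairing] at h
  · have h := lowLin_symm (1 : Matrix σ σ ℝ) hT _ (SiegelParabolicPi.cMat_isSymm (T := (1 : Matrix σ σ ℝ)) g') x x'
    rwa [toLinearMap₂'_one_eq_dotPairing] at h
  · apply Subtype.ext
    have h := congrArg Subtype.val key
    exact h
  · rw [glEquiv_apply, SiegelParabolicPi.coe_aGL, SiegelParabolicPi.aMat, LinearMap.toMatrix'_mulVec,
      SiegelParabolicPi.aLin_apply]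

omit [Fintype σ] [DecidableEq σ] in
/-- the determinant of the Levi factor is that of the `X`-block `x ↦ (g(x, 0)).1`. [cite: Weil1964, Chap. III n° 46 p. 202] -/
theorem det_eq_of_forall_apply {a : (σ → ℝ) ≃ₗ[ℝ] (σ → ℝ)} {f : (σ → ℝ) →ₗ[ℝ] (σ → ℝ)} (h : ∀ x, a x = f x) :
    LinearMap.det (a : (σ → ℝ) →ₗ[ℝ] (σ → ℝ)) = LinearMap.det f := by
  congr 1
  exact LinearMap.ext h

end Literature.NumberTheory.Weil1964

end
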